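import Mathlib

/-!
# Tier4/Line4/TraceZeroQuad — a trace-zero quadratic generator of a CM field: `DescribesCM ⟨0, n⟩` unfolded

Blind re-derivation cell `pub-hodge-repro`, Tier 4 (README §9–§10), seat t4-typer-2 (gen 5), on plan-4 g7's brief
S15975 (C-L4-Q0, taken S15994 in x1's absence).  Target tree path `lean/Summits/Ventures/HodgeRepro/Tier4/Line4/TraceZeroQuad.lean`;
imports Mathlib only.

WHAT IS TYPED — for a CM field `E` with maximal real subfield `E⁺ = maximalRealSubfield E` and complex conjugation
`c = IsCMField.complexConj E`: there are `n ∈ E⁺` and `ω ∈ E` with `ω² = 0 · ω − n`, `c ω = 0 − ω` and `c ω ≠ ω` — the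
skeleton's `DescribesCM ⟨0, n⟩` (L4 v0.43 L867, a `def` of the skeleton, consumed by `exact`) unfolded: the quadratic datum
of trace ZERO that the (7b) WLOG `(ht : q.t = 0)` (v0.43 S15899) assumes is realised for EVERY CM field, so the costume's
choice `q := ⟨0, n⟩` costs nothing (crit-2 Entry 373 R1's record `describesCM_recentre`, discharged by name).
PROOF: `c ≠ 1` (`IsCMField.complexConj_ne_one`) gives `x` with `c x ≠ x`; `ω := x − c x` has `c ω = −ω` and `ω ≠ 0`;
`c (ω²) = (c ω)² = ω²`, so `ω² ∈ E⁺` (`IsCMField.complexConj_eq_self_iff`); `n := −⟨ω², _⟩`.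

Nothing here says anything about the status of the Hodge conjecture for CM abelian varieties, which is NOT proved
(HC_CM is NOT proved by anyone in this repository).
-/

set_option autoImplicit false

noncomputable section

open NumberField

namespace Summit.Ventures.HodgeRepro.Tier4.Line4

/-- Some element of a CM field is moved by complex conjugation. -/
theorem exists_complexConj_ne (E : Type) [Field E] [NumberField E] [IsCMField E] :
    ∃ x : E, IsCMField.complexConj E x ≠ x := by
  by_contra h
  exact IsCMField.complexConj_ne_one E (AlgEquiv.ext fun x => by simpa using not_exists.1 h x)

/-- **A trace-zero quadratic generator**: `∃ n ∈ E⁺, ∃ ω ∈ E, ω² = 0 · ω − n ∧ c ω = 0 − ω ∧ c ω ≠ ω` — the skeleton's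
`DescribesCM ⟨0, n⟩` unfolded (`c = IsCMField.complexConj E`, `E⁺ = maximalRealSubfield E`). -/
theorem exists_traceZero_describesCM (E : Type) [Field E] [NumberField E] [IsCMField E] :
    ∃ n : ↥(maximalRealSubfield E), ∃ ω : E,
      ω ^ 2 = algebraMap _ E (0 : ↥(maximalRealSubfield E)) * ω - algebraMap _ E n ∧
      (IsCMField.complexConj E) ω = algebraMap _ E (0 : ↥(maximalRealSubfield E)) - ω ∧
      (IsCMField.complexConj E) ω ≠ ω := by
  obtain ⟨x, hx⟩ := exists_complexConj_ne E
  set ω : E := x - IsCMField.complexConj E x with hω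
  have hcω : IsCMField.complexConj E ω = -ω := by
    rw [hω, map_sub, IsCMField.complexConj_apply_apply, neg_sub]
  have hω0 : ω ≠ 0 := by
    rw [hω]
    exact sub_ne_zero.2 (Ne.symm hx)
  have hsq : ω ^ 2 ∈ maximalRealSubfield E := by
    rw [← IsCMField.complexConj_eq_self_iff, map_pow, hcω, neg_sq]
  refine ⟨-⟨ω ^ 2, hsq⟩, ω, ?_, ?_, ?_⟩
  · rw [map_zero, zero_mul, map_neg, zero_sub, neg_neg]
    rfl
  · rw [hcω, map_zero, zero_sub]
  · rw [hcω]
    intro h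
    apply hω0
    have : (2 : E) * ω = 0 := by linear_combination -h
    rcases mul_eq_zero.1 this with h2 | h2
    · exact absurd h2 two_ne_zero
    · exact h2

end Summit.Ventures.HodgeRepro.Tier4.Line4
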